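import Literature.MathematicalPhysics.QuantumLattice.Imbrie2016.A2Variants

/-!
# Imbrie (2016): the weak form (5.8) of A2 run through the bookkeeping of §4.2/§5 — the consumed
f-currency instance and the arithmetic of the volume/separation consistency condition (kernel-checked)

CITATION HEADER (lean-in-tree rule 2026-08-18). J. Z. Imbrie, *On many-body localization for quantum spin chains*,
J. Stat. Phys. **163** (2016) 998–1048, doi 10.1007/s10955-016-1508-x, arXiv:1403.7837 [ImbrieJSP2016], §4.2.1, §4.2.4, §5.
WHAT IS TYPED, verbatim sources:
* `A2weakConsumed` — the instance of the weak form (5.8) that the proof of Thm 5.1 consumes when the level-spacing test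
  printed (5.3) [`min_{α≠β}|E_α − E_β| ≥ ε^{sϰn}`, "where n is the number of sites in b̄^{(j)} … the size of b̿^{(j)} is no
  greater than some multiple m of n … let ε̃ = ε^{sϰ/m} and take ε̃ ≤ ε₀"] fails for a box of n′ ∈ [n, mn] sites: the
  failure event is charged ε̃^{ν(1 + c₄ (log n′)²)} = f^{1 + c₄ (log n′)²} with the single currency f := ε̃^ν = ε^{sϰν/m}
  (ε = γ^{1/20}).  Source of the weak form, p. 35: "we could make do with a weaker form of A2(ν,ε₀), replacing (5.1) with
  P(min_{α≠β}|E_α − E_β| < ε̃ⁿ) ≤ ε̃^{ν(1+c₄(log n)²)}, for some constant c₄."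
* `scaleL k = (15/8)^k` and `sepD m₀ m = exp(√(L_{m+m₀}))` — §4.2.1 (dist): "dist(b₁, b₂) > d_m ≡ exp(L^{1/2}_{m+m₀}) if
  min{|b₁|, |b₂|} ∈ [L_{m−1}, L_m)" and "L_k ≡ (15/8)^k" (proof of Prop. 4.3, before (4.22)).
WHAT IS PROVED (elementary arrows only; audit cell `pub-imbrie`, seat 1 gen 10, LLA.md block WA):
* `A2weakConsumed_of_A2weak` — A2weak(ν, ε₀, c₄) ⟹ A2weakConsumed, the exponent arithmetic of the quoted sentence with A2
  replaced by (5.8): ε′ := ε^{sϰn/n′} ≤ ε̃ ≤ ε₀, ε′^{n′} = ε^{sϰn}, and ε′^{ν(1+c₄ log² n′)} ≤ ε̃^{ν(1+c₄ log² n′)}.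
* `scaleL_succ_lt_of_sepD_lt`, `weakVolume_ge_of_sepD_lt` — the arithmetic of the audit's consistency condition (DL_w)
  "1 + c₄ (log N)² ≥ L_{m−1} whenever d_{m−2} < N", valid as soon as c₄ ≥ (15/8)^{1−m₀}: a failed box of N sites, carrying
  weight f^{1 + c₄ log² N}, has at least the minimum volume (4.21) of the volume class whose blocks may be as long as it is,
  so the separation rules and the diameter lemma of §4.2.1 apply to it unchanged.  `classTwo_volume` is the class-2 case.
STATUS: `A2weak`, `A2weakConsumed` are HYPOTHESES of the paper / of the audit and are never asserted; nothing here bears on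
their truth, nor on Prop. 4.3 itself (whose counting is not formalised).  [cite: ImbrieJSP2016, eq. (5.8), §5 proof of Thm 5.1]
-/

noncomputable section
open _root_.MeasureTheory

namespace Literature.MathematicalPhysics.QuantumLattice.Imbrie2016

/-- **The consumed instance of the weak form (5.8)** in the single currency f = ε^{sϰν/m} (ε = γ^{1/20}): for a block of
n ≥ 1 sites sitting in a box of n′ ∈ [n, m n] sites, the failure of the test `min gap ≥ ε^{sϰn}` has probability at most
ε^{(sϰν/m)(1 + c₄ (log n′)²)} = f^{1 + c₄ (log n′)²}.  UNPROVED hypothesis shape; never asserted.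
[cite: ImbrieJSP2016, eq. (5.8); §5 proof of Thm 5.1 (the paragraph containing printed (5.3))] -/
def A2weakConsumed (L : Laws) (γ ν s ϰ c₄ : ℝ) (m : ℕ) : Prop :=
  ∀ (a : ℤ) (n n' : ℕ), 0 < n → n ≤ n' → n' ≤ m * n →
    L.boxMeasure a n' {t | SmallGap γ ((γ ^ (1 / 20 : ℝ)) ^ (s * ϰ * n)) (Params.ofTriple t)}
      ≤ ENNReal.ofReal ((γ ^ (1 / 20 : ℝ)) ^ ((s * ϰ * ν / m) * (1 + c₄ * Real.log n' ^ 2)))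

/-- **A2weak(ν, ε₀, c₄) ⟹ A2weakConsumed** as soon as ε̃ := ε^{sϰ/m} ≤ ε₀ (ε = γ^{1/20}, 0 < γ ≤ 1; ν, s, ϰ, c₄ ≥ 0):
apply the weak form in the box of n′ sites with ε′ := ε^{sϰn/n′} (so ε′^{n′} = ε^{sϰn} and ε′ ≤ ε̃ ≤ ε₀ because n′ ≤ mn),
then compare exponents: (sϰn/n′)·ν(1 + c₄ log² n′) ≥ (sϰ/m)·ν(1 + c₄ log² n′) and the base is ≤ 1.
[cite: ImbrieJSP2016, eq. (5.8); §5 proof of Thm 5.1] -/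
theorem A2weakConsumed_of_A2weak {L : Laws} {γ ν ε₀ c₄ s ϰ : ℝ} {m : ℕ} (hγ : 0 < γ) (hγ1 : γ ≤ 1)
    (hν : 0 ≤ ν) (hc₄ : 0 ≤ c₄) (hs : 0 ≤ s) (hϰ : 0 ≤ ϰ)
    (hε₀ : (γ ^ (1 / 20 : ℝ)) ^ (s * ϰ / m) ≤ ε₀) (h : A2weak L γ ν ε₀ c₄) :
    A2weakConsumed L γ ν s ϰ c₄ m := by
  intro a n n' hn hnn' hn'm
  have hε0 : 0 < γ ^ (1 / 20 : ℝ) := Real.rpow_pos_of_pos hγ _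
  have hε1 : γ ^ (1 / 20 : ℝ) ≤ 1 := Real.rpow_le_one hγ.le hγ1 (by norm_num)
  have hn'0 : 0 < n' := lt_of_lt_of_le hn hnn'
  have hn'R : (0 : ℝ) < n' := by exact_mod_cast hn'0
  have hnR : (0 : ℝ) < n := by exact_mod_cast hn
  have hm0 : 0 < m := by
    rcases Nat.eq_zero_or_pos m with hm | hm
    · subst hm; simp at hn'm; omega
    · exact hm
  have hmR : (0 : ℝ) < m := by exact_mod_cast hm0
  have hle : (n' : ℝ) ≤ m * n := by exact_mod_cast hn'm
  -- the exponent used in the box of size n' dominates sϰ/m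
  have hexp : s * ϰ / m ≤ s * ϰ * n / n' := by
    have hsk : 0 ≤ s * ϰ := mul_nonneg hs hϰ
    have h1 : (1 : ℝ) / m ≤ n / n' := by
      rw [le_div_iff₀ hn'R]
      calc (1 : ℝ) / m * n' ≤ 1 / m * (m * n) := mul_le_mul_of_nonneg_left hle (by positivity)
        _ = n := by field_simp
    have h2 : s * ϰ / m = (s * ϰ) * (1 / m) := by ring
    have h3 : s * ϰ * n / n' = (s * ϰ) * (n / n') := by ring
    rw [h2, h3]
    exact mul_le_mul_of_nonneg_left h1 hsk
  have hε'0 : 0 < (γ ^ (1 / 20 : ℝ)) ^ (s * ϰ * n / n') := Real.rpow_pos_of_pos hε0 _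
  have hε'1 : (γ ^ (1 / 20 : ℝ)) ^ (s * ϰ * n / n') ≤ 1 :=
    Real.rpow_le_one hε0.le hε1 (by positivity)
  have hε'le : (γ ^ (1 / 20 : ℝ)) ^ (s * ϰ * n / n') ≤ ε₀ :=
    (Real.rpow_le_rpow_of_exponent_ge hε0 hε1 hexp).trans hε₀
  have key := h a n' hn'0 _ hε'0 hε'le
  -- the tested threshold: ε'^{n'} = ε^{sϰn}
  have e1 : ((γ ^ (1 / 20 : ℝ)) ^ (s * ϰ * n / n')) ^ n' = (γ ^ (1 / 20 : ℝ)) ^ (s * ϰ * n) := by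
    rw [← Real.rpow_natCast, ← Real.rpow_mul hε0.le]
    congr 1
    field_simp
  -- the charged weight: ε'^{ν(1 + c₄ log² n')} ≤ ε̃^{ν(1 + c₄ log² n')}
  have hX : 0 ≤ ν * (1 + c₄ * Real.log n' ^ 2) := by positivity
  have e2 : ((γ ^ (1 / 20 : ℝ)) ^ (s * ϰ * n / n')) ^ (ν * (1 + c₄ * Real.log n' ^ 2))
      ≤ (γ ^ (1 / 20 : ℝ)) ^ ((s * ϰ * ν / m) * (1 + c₄ * Real.log n' ^ 2)) := by
    rw [← Real.rpow_mul hε0.le]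
    apply Real.rpow_le_rpow_of_exponent_ge hε0 hε1
    have : s * ϰ * ν / m * (1 + c₄ * Real.log n' ^ 2) = (s * ϰ / m) * (ν * (1 + c₄ * Real.log n' ^ 2)) := by ring
    rw [this]
    exact mul_le_mul_of_nonneg_right hexp hX
  rw [e1] at key
  exact key.trans (ENNReal.ofReal_le_ofReal e2)

/-- Scale lengths of §4.2.1: L_k ≡ (15/8)^k (integer index, so that L_{m−1}, L_{1−m₀} make sense).
[cite: ImbrieJSP2016, §4.2.1 (dist) and proof of Prop. 4.3 ("L_k ≡ (15/8)^k")] -/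
def scaleL (k : ℤ) : ℝ := (15 / 8 : ℝ) ^ k

/-- Separation distances of §4.2.1: d_m ≡ exp(L^{1/2}_{m+m₀}); m₀ is the paper's free design parameter ("for an
appropriate choice of m₀"). [cite: ImbrieJSP2016, §4.2.1 (dist)] -/
def sepD (m₀ : ℕ) (m : ℤ) : ℝ := Real.exp (Real.sqrt (scaleL (m + m₀)))

/-- L_k > 0. [cite: ImbrieJSP2016, §4.2.1 (dist)] -/
theorem scaleL_pos (k : ℤ) : 0 < scaleL k := by
  unfold scaleL; positivity

/-- L_{j+k} = L_j · L_k (geometric scale sequence). [cite: ImbrieJSP2016, §4.2.1 (dist)] -/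
theorem scaleL_add (j k : ℤ) : scaleL (j + k) = scaleL j * scaleL k := by
  unfold scaleL
  rw [zpow_add₀ (by norm_num : (15 / 8 : ℝ) ≠ 0)]

/-- If d_j < N (N ≥ 1) then L_{j+m₀} < (log N)²: take logarithms in exp(√L_{j+m₀}) < N and square.
[cite: ImbrieJSP2016, §4.2.1 (dist); eq. (4.21)] -/
theorem scaleL_lt_log_sq_of_sepD_lt {m₀ : ℕ} {j : ℤ} {N : ℝ} (hN : 1 ≤ N)
    (h : sepD m₀ j < N) : scaleL (j + m₀) < Real.log N ^ 2 := by
  have hNpos : 0 < N := lt_of_lt_of_le one_pos hN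
  have hsqrt : Real.sqrt (scaleL (j + m₀)) < Real.log N := by
    have := Real.log_lt_log (Real.exp_pos _) h
    rwa [Real.log_exp] at this
  have hs0 : 0 ≤ Real.sqrt (scaleL (j + m₀)) := Real.sqrt_nonneg _
  have hL0 : 0 ≤ scaleL (j + m₀) := (scaleL_pos _).le
  calc scaleL (j + m₀) = Real.sqrt (scaleL (j + m₀)) ^ 2 := (Real.sq_sqrt hL0).symm
    _ < Real.log N ^ 2 := by
        have hlog0 : 0 ≤ Real.log N := Real.log_nonneg hN
        nlinarith

/-- **The arithmetic of the audit's consistency condition (DL_w)** (LLA.md block WA, Lemma WA3(a)).  If the separation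
distance two classes down is shorter than the failed box, d_{m−2} < N, and c₄ ≥ (15/8)^{1−m₀}, then the minimum volume
L_{m−1} of class m is at most c₄ (log N)² — so a failed box of N sites charged f^{1 + c₄ (log N)²} carries at least the
volume of the least class whose blocks may be as long as it is, and the separation rules/diameter lemma of §4.2.1 apply
to it verbatim.  The threshold (15/8)^{1−m₀} is ≍ Imbrie's own c₃ of (4.24) (same computation run on (4.21)), and m₀ is
free, so every c₄ > 0 is admissible.  [cite: ImbrieJSP2016, eq. (5.8); §4.2.1 (dist); eq. (4.21)–(4.22)] -/
theorem weakVolume_ge_of_sepD_lt {m₀ : ℕ} {m : ℤ} {N c₄ : ℝ} (hN : 1 ≤ N)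
    (hsep : sepD m₀ (m - 2) < N) (hc₄ : scaleL (1 - m₀) ≤ c₄) :
    scaleL (m - 1) ≤ 1 + c₄ * Real.log N ^ 2 := by
  have hlt : scaleL (m - 2 + m₀) < Real.log N ^ 2 := scaleL_lt_log_sq_of_sepD_lt hN hsep
  have hsplit : scaleL (m - 1) = scaleL (1 - m₀) * scaleL (m - 2 + m₀) := by
    rw [← scaleL_add]; congr 1; ring
  have h1 : 0 < scaleL (1 - m₀) := scaleL_pos _
  have hlog2 : 0 ≤ Real.log N ^ 2 := sq_nonneg _
  calc scaleL (m - 1) = scaleL (1 - m₀) * scaleL (m - 2 + m₀) := hsplit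
    _ ≤ scaleL (1 - m₀) * Real.log N ^ 2 := mul_le_mul_of_nonneg_left hlt.le h1.le
    _ ≤ c₄ * Real.log N ^ 2 := mul_le_mul_of_nonneg_right hc₄ hlog2
    _ ≤ 1 + c₄ * Real.log N ^ 2 := by linarith

/-- Class-2 case of (DL_w) (Lemma WA3(b)): L_1 = 15/8 ≤ 1 + c₄ (log N)² iff c₄ (log N)² ≥ 7/8; for the boxes on which the
weak form is actually invoked (block size ≥ N_* = 20/(sνϰ)) this is the condition c₄ (log N_*)² ≥ 7/8 on ϰ.
[cite: ImbrieJSP2016, eq. (5.8); §4.2.1 (dist)] -/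
theorem classTwo_volume {N c₄ : ℝ} (h : 7 / 8 ≤ c₄ * Real.log N ^ 2) :
    scaleL 1 ≤ 1 + c₄ * Real.log N ^ 2 := by
  unfold scaleL; norm_num; linarith

/-- The currency comparison used in (M2) of block WA: with 0 < f ≤ 1, any assigned volume v ≤ 1 + c₄ (log N)² is covered
by the charged weight, f^{1 + c₄ (log N)²} ≤ f^{v}. [cite: ImbrieJSP2016, eq. (5.8); proof of Prop. 4.3 ("a factor ε^s for
each site of b^{(k)}")] -/
theorem weakWeight_le_pow_volume {f v c₄ N : ℝ} (hf0 : 0 < f) (hf1 : f ≤ 1)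
    (hv : v ≤ 1 + c₄ * Real.log N ^ 2) :
    f ^ (1 + c₄ * Real.log N ^ 2) ≤ f ^ v :=
  Real.rpow_le_rpow_of_exponent_ge hf0 hf1 hv

end Literature.MathematicalPhysics.QuantumLattice.Imbrie2016

end
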